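import Mathlib

/-!
# Route `FilamentSkeletonRss` · child crux `TangentSkeletonNearStraightL` (stmt-NavierStokesRegularity-23320) · registered line
# `child_tangent_analytic_strip_L` (b0b56c52900dd90a), stub `stub_stripPropagation` — brick: THE TANGENTIAL CHORD ESTIMATE (own filament, unshifted far part)

R4′ of the STUB-PLAN memo attached to 23320.  For the own filament's UNSHIFTED far part the source `X(σ)` is at distance only `2–3·|Im z|` from the
target's real foot, so the crude unshifted estimate (`Theorems.StadiumFarKernelBound`, `d ≥ 16|y|`) does not apply; positivity of the complexified
squared chord comes instead from the TANGENT STRUCTURE: the displacement is `w = a·t̄ + e` with the complex scalar `a = (x − σ) + iy`, the real unit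
mean tangent `t̄`, and a small remainder `e` (vertical displacement minus `iy·t̄`: tangent modulus; real chord minus `(x−σ)t̄`: near-straightness).  Then
* `re_sum_sq_tangential_ge` — `Re Σᵢ (a·t̄ᵢ + eᵢ)² ≥ Re(a²) − 6‖a‖ε − 3ε²` for `Σ t̄ᵢ² = 1`, `|t̄ᵢ| ≤ 1`, `‖eᵢ‖ ≤ ε`;
* `re_sq_of_horizontal_vertical` — `Re(((x−σ : ℝ) + y·i)²) = (x−σ)² − y²` and `‖(x−σ) + y i‖ ≤ |x−σ| + |y|`,
so `Re Q ≥ (x−σ)² − y² − 6(|x−σ|+|y|)ε − 3ε²`, positive for `|x−σ| ≥ 2.8|y|` when `ε ≤ 0.15(|x−σ|+|y|)` (i.e. `η + Rb ≲ 0.15` with the sup-norm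
constants; the consumer's constant chase).
HONEST FRAMING: an algebra brick for a plan about a HYPOTHETICAL filament skeleton on the NEGATIVE side of a MODEL route; the stub `stub_stripPropagation`
is NOT closed; nothing here bears on Navier–Stokes regularity or blow-up.  `--supports stmt-NavierStokesRegularity-23320`.
-/

set_option linter.dupNamespace false

noncomputable section

namespace Summit.NavierStokesRegularity.NavierStokesRegularity.Theorems.StadiumTangentialChord

open Complex

/-- One coordinate: `Re (a t + e)² ≥ t²·Re(a²) − 2‖a‖ε − ε²` for real `t` with `|t| ≤ 1` and `‖e‖ ≤ ε`. [folklore] -/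
theorem re_sq_coord_ge (a e : ℂ) {t ε : ℝ} (ht : |t| ≤ 1) (he : ‖e‖ ≤ ε) :
    t ^ 2 * (a ^ 2).re - 2 * ‖a‖ * ε - ε ^ 2 ≤ ((a * (t : ℂ) + e) ^ 2).re := by
  have hε : 0 ≤ ε := (norm_nonneg _).trans he
  have hexp : (a * (t : ℂ) + e) ^ 2 = (t : ℂ) ^ 2 * a ^ 2 + 2 * (t : ℂ) * (a * e) + e ^ 2 := by ring
  rw [hexp, add_re, add_re]
  have h1 : ((t : ℂ) ^ 2 * a ^ 2).re = t ^ 2 * (a ^ 2).re := by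
    rw [← ofReal_pow, re_ofReal_mul]
  have h2 : |(2 * (t : ℂ) * (a * e)).re| ≤ 2 * ‖a‖ * ε := by
    calc |(2 * (t : ℂ) * (a * e)).re| ≤ ‖2 * (t : ℂ) * (a * e)‖ := abs_re_le_norm _
      _ = 2 * |t| * (‖a‖ * ‖e‖) := by
          rw [norm_mul, norm_mul, norm_mul, Complex.norm_real, Real.norm_eq_abs]
          norm_num
      _ ≤ 2 * 1 * (‖a‖ * ε) := by gcongr
      _ = 2 * ‖a‖ * ε := by ring
  have h3 : |(e ^ 2).re| ≤ ε ^ 2 := by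
    calc |(e ^ 2).re| ≤ ‖e ^ 2‖ := abs_re_le_norm _
      _ = ‖e‖ ^ 2 := norm_pow _ _
      _ ≤ ε ^ 2 := pow_le_pow_left₀ (norm_nonneg _) he 2
  rw [h1]
  linarith [neg_abs_le (2 * (t : ℂ) * (a * e)).re, neg_abs_le (e ^ 2).re]

/-- **Tangential chord estimate.**  For a real vector `t̄` with `Σᵢ t̄ᵢ² = 1`, a complex scalar `a` and a remainder `e` with `‖eᵢ‖ ≤ ε`:
`Re(a²) − 6‖a‖ε − 3ε² ≤ Re Σᵢ (a·t̄ᵢ + eᵢ)²`. [folklore] -/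
theorem re_sum_sq_tangential_ge (tbar : Fin 3 → ℝ) (a : ℂ) (e : Fin 3 → ℂ) {ε : ℝ}
    (hunit : ∑ i, (tbar i) ^ 2 = 1) (he : ∀ i, ‖e i‖ ≤ ε) :
    (a ^ 2).re - 6 * ‖a‖ * ε - 3 * ε ^ 2 ≤ (∑ i, (a * (tbar i : ℂ) + e i) ^ 2).re := by
  have hti : ∀ i, |tbar i| ≤ 1 := by
    intro i
    have h1 : (tbar i) ^ 2 ≤ ∑ j, (tbar j) ^ 2 :=
      Finset.single_le_sum (fun j _ => sq_nonneg (tbar j)) (Finset.mem_univ i)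
    rw [hunit] at h1
    exact abs_le_one_iff_mul_self_le_one.2 (by nlinarith [h1])
  have hcoord := fun i => re_sq_coord_ge a (e i) (hti i) (he i)
  rw [Complex.re_sum]
  simp only [Fin.sum_univ_three] at hunit ⊢
  have h0 := hcoord 0
  have h1 := hcoord 1
  have h2 := hcoord 2
  have hsum : tbar 0 ^ 2 * (a ^ 2).re + tbar 1 ^ 2 * (a ^ 2).re + tbar 2 ^ 2 * (a ^ 2).re = (a ^ 2).re := by
    rw [← add_mul, ← add_mul, hunit, one_mul]
  linarith

/-- The scalar of the own-filament far part: `a = (x − σ) + y·i` has `Re(a²) = (x−σ)² − y²` and `‖a‖ ≤ |x−σ| + |y|`. [folklore] -/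
theorem re_sq_of_horizontal_vertical (d y : ℝ) :
    ((((d : ℂ) + (y : ℂ) * I)) ^ 2).re = d ^ 2 - y ^ 2 ∧ ‖(d : ℂ) + (y : ℂ) * I‖ ≤ |d| + |y| := by
  constructor
  · simp [sq, mul_re, mul_im, add_re, add_im]
  · calc ‖(d : ℂ) + (y : ℂ) * I‖ ≤ ‖(d : ℂ)‖ + ‖(y : ℂ) * I‖ := norm_add_le _ _
      _ = |d| + |y| := by rw [norm_mul, Complex.norm_I, mul_one, Complex.norm_real, Complex.norm_real, Real.norm_eq_abs, Real.norm_eq_abs]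

end Summit.NavierStokesRegularity.NavierStokesRegularity.Theorems.StadiumTangentialChord

end
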